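import Literature.NumberTheory.EllipticCurves.IsogenyDualProofs
import Literature.NumberTheory.EllipticCurves.SelmerCorankProofs
import Mathlib.LinearAlgebra.Dimension.Torsion.Basic
import HarnessLib

/-!
# Isogenous elliptic curves have the same Mordell–Weil rank (discharge of
`WeierstrassCurve.mordellWeilRank_eq_of_isIsogenous`)

Sibling proof file of the prelude `Literature.NumberTheory.EllipticCurves.Isogeny` for its named
fact `WeierstrassCurve.mordellWeilRank_eq_of_isIsogenous`:

> over a number field `K`, `K`-isogenous elliptic curves `E ∼ E'` have
> `rank_ℤ E(K) = rank_ℤ E'(K)` (`WeierstrassCurve.mordellWeilRank = Module.finrank ℤ E(K)`).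

This is the remark "`r` is the common rank of the groups of `K`-rational points on the four
abelian varieties" in Milne's proof of the isogeny invariance of the Birch–Swinnerton-Dyer
conjecture (*Arithmetic Duality Theorems*, 2nd ed., proof of Thm. I.7.3, p. 97), and the content
of Silverman, *AEC*, III.6.2 (the dual isogeny, `φ̂ ∘ φ = [m]`) read against Ch. VIII (the rank
of `E(K)`). It is **discharged** here (`WeierstrassCurve.mordellWeilRank_eq_of_isIsogenous_holds`),
with no hypothesis beyond those of the fact and *without* the Mordell–Weil theorem: an isogeny
`φ : E → E'` over `K` induces a homomorphism `E(K) → E'(K)` with finite, hence torsion, kernel, so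
`rank_ℤ E(K) = rank_ℤ (E(K)/ker) ≤ rank_ℤ E'(K)` as cardinals (Mathlib's
`rank_quotient_eq_of_le_torsion`), and the dual isogeny (proved in the tree,
`WeierstrassCurve.Isogeny.exists_dual_of_isElliptic`, `IsogenyDualProofs.lean`) gives the reverse
inequality; equal ranks have equal `finrank`s whether or not the groups are finitely generated.

## Contents (all proved; no definitions)

* `WeierstrassCurve.Isogeny.exists_pointHom`: **an isogeny over a perfect field `K` induces a
  group homomorphism `E(K) →+ E'(K)` compatible with `E(K) ↪ E(K̄)`** (descent of the
  `Γ_K`-equivariant map on geometric points: `E(K) = E(K̄)^{Γ_K}` maps into `E'(K̄)^{Γ_K} = E'(K)`,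
  the tree's Galois descent `WeierstrassCurve.exists_toGeomPoints_eq_of_forall_smul_eq`;
  Silverman *AEC* III.4 with VIII.§1);
* `WeierstrassCurve.Isogeny.isOfFinAddOrder_of_pointHom_eq_zero`,
  `WeierstrassCurve.Isogeny.ker_le_torsion_of_pointHom`: its kernel consists of torsion points
  (it embeds in the finite kernel `E[φ] ⊆ E(K̄)`);
* `WeierstrassCurve.Isogeny.rank_point_le`: `Module.rank ℤ E(K) ≤ Module.rank ℤ E'(K)`;
* `WeierstrassCurve.Isogeny.mordellWeilRank_eq`, `WeierstrassCurve.IsIsogenous.mordellWeilRank_eq`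
  (characteristic `0`, both curves elliptic: the dual isogeny) and the discharge
  `WeierstrassCurve.mordellWeilRank_eq_of_isIsogenous_holds`.

## Design

* Theorems only (kernel-reviewed sibling); the fact in `Isogeny.lean` is untouched and keeps its
  `def`; users holding `(h : mordellWeilRank_eq_of_isIsogenous)` are fed `…_holds`.
* The inclusion `E(K) ↪ E(K̄)` is the tree's `WeierstrassCurve.toGeomPoints`
  (`= Affine.Point.baseChange K K̄`, with `toGeomPoints_injective`, `smul_toGeomPoints` and the
  descent lemma), imported from `SelmerCorankProofs.lean` where it was introduced; it is reused,
  not restated, at the price of that import.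
* `noncomputable section`, `open scoped Classical` as in `MordellWeil.lean`, so that `E(K)` carries
  the same (classical) `AddCommGroup` instance as in `WeierstrassCurve.mordellWeilRank`.
* The rank statements are over `ℤ` as cardinals first (`Module.rank`), so that no finite generation
  is needed; `mordellWeilRank` is `Cardinal.toNat` of it (`Module.finrank`).

## References

* J. S. Milne, *Arithmetic Duality Theorems*, 2nd ed. (2006), I.7, proof of Thm. 7.3 (p. 97: "where
  `r` is the common rank of the groups of `K`-rational points on the four abelian varieties") and
  Lemma 7.1 (p. 96). [MilneADT2006]
* J. H. Silverman, *The Arithmetic of Elliptic Curves*, 2nd ed. (2009), III.4 (isogenies are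
  homomorphisms with finite kernel, III.4.8–4.9), III.6.1–6.2 (dual isogeny), VIII.§1
  (`E(K̄)^{G_K} = E(K)`). [SilvermanAEC2009]
-/

noncomputable section

open scoped Classical

universe u

namespace WeierstrassCurve

variable {K : Type u} [Field K] {W W' : WeierstrassCurve K}

namespace Isogeny

/-! ### The homomorphism on rational points induced by an isogeny -/

/-- **An isogeny over `K` induces a homomorphism `E(K) →+ E'(K)`** (for `K` perfect): the
`Γ_K`-equivariant homomorphism `φ : E(K̄) →+ E'(K̄)` maps `E(K) = E(K̄)^{Γ_K}` into
`E'(K̄)^{Γ_K} = E'(K)` (Galois descent), and the resulting map is additive because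
`E'(K) ↪ E'(K̄)` is an injective homomorphism. Stated as the existence of
`f : E(K) →+ E'(K)` with `f P = φ P` in `E'(K̄)` (`WeierstrassCurve.toGeomPoints` the inclusions).
Silverman, *AEC*, III.4 (isogenies defined over `K`) with VIII.§1 (`E(K̄)^{G_K} = E(K)`).
[cite: SilvermanAEC2009, III.4 and VIII.§1] -/
theorem exists_pointHom [PerfectField K] (φ : Isogeny W W') :
    ∃ f : W.toAffine.Point →+ W'.toAffine.Point, ∀ P : W.toAffine.Point,
      W'.toGeomPoints (f P) = φ (W.toGeomPoints P) := by
  have hex : ∀ P : W.toAffine.Point, ∃ Q : W'.toAffine.Point,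
      W'.toGeomPoints Q = φ (W.toGeomPoints P) :=
    fun P => exists_toGeomPoints_eq_of_forall_smul_eq W' fun σ => by
      rw [← φ.map_smul, smul_toGeomPoints]
  choose f hf using hex
  refine ⟨AddMonoidHom.mk' f fun P Q => toGeomPoints_injective W' ?_, hf⟩
  simp only [map_add, hf]

/-- A point of `E(K)` killed by the homomorphism `E(K) → E'(K)` induced by an isogeny has finite
order: its image in `E(K̄)` lies in the finite kernel `E[φ]`. Silverman, *AEC*, III.4.9 (the
kernel of a non-zero isogeny is finite). [cite: SilvermanAEC2009, III.4, Cor. 4.9] -/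
theorem isOfFinAddOrder_of_pointHom_eq_zero (φ : Isogeny W W')
    {f : W.toAffine.Point →+ W'.toAffine.Point}
    (hf : ∀ P : W.toAffine.Point, W'.toGeomPoints (f P) = φ (W.toGeomPoints P))
    {P : W.toAffine.Point} (hP : f P = 0) : IsOfFinAddOrder P := by
  -- the image of `P` in `E(K̄)` lies in the finite kernel of `φ`
  have hker : W.toGeomPoints P ∈ φ.toAddMonoidHom.ker := by
    rw [AddMonoidHom.mem_ker, coe_toAddMonoidHom, ← hf, hP, map_zero]
  have hfin : IsOfFinAddOrder (W.toGeomPoints P) :=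
    φ.toAddMonoidHom.ker.subtype.isOfFinAddOrder (isOfFinAddOrder_of_finite (⟨_, hker⟩ : _))
  -- hence `P` has finite order, `E(K) ↪ E(K̄)` being an injective homomorphism
  obtain ⟨n, hn, hnP⟩ := (isOfFinAddOrder_iff_nsmul_eq_zero).1 hfin
  refine (isOfFinAddOrder_iff_nsmul_eq_zero).2 ⟨n, hn, toGeomPoints_injective W ?_⟩
  rw [map_nsmul, map_zero]
  exact hnP

/-- The kernel of the homomorphism `E(K) → E'(K)` induced by an isogeny consists of `ℤ`-torsion
elements of `E(K)` (`isOfFinAddOrder_of_pointHom_eq_zero`). Silverman, *AEC*, III.4.9.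
[cite: SilvermanAEC2009, III.4, Cor. 4.9] -/
theorem ker_le_torsion_of_pointHom (φ : Isogeny W W') {f : W.toAffine.Point →+ W'.toAffine.Point}
    (hf : ∀ P : W.toAffine.Point, W'.toGeomPoints (f P) = φ (W.toGeomPoints P)) :
    LinearMap.ker f.toIntLinearMap ≤ Submodule.torsion ℤ W.toAffine.Point := by
  intro P hP
  obtain ⟨n, hn, hnP⟩ :=
    (isOfFinAddOrder_iff_nsmul_eq_zero).1 (φ.isOfFinAddOrder_of_pointHom_eq_zero hf hP)
  rw [Submodule.mem_torsion_iff]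
  refine ⟨⟨(n : ℤ), mem_nonZeroDivisors_of_ne_zero (by exact_mod_cast hn.ne')⟩, ?_⟩
  change (n : ℤ) • P = 0
  rw [natCast_zsmul]
  exact hnP

/-- **`rank_ℤ E(K) ≤ rank_ℤ E'(K)` along an isogeny `E → E'` over a perfect field `K`**, as
cardinals and without any finite generation: the induced map `f : E(K) → E'(K)` has torsion
kernel, so `rank E(K) = rank (E(K)/ker f)` (Mathlib `rank_quotient_eq_of_le_torsion`) and
`E(K)/ker f ≅ im f ⊆ E'(K)`. Milne, *ADT*, proof of Thm. I.7.3 ("the common rank");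
Silverman, *AEC*, III.6.2 with VIII. [cite: MilneADT2006, proof of Thm. I.7.3 (p. 97)] -/
theorem rank_point_le [PerfectField K] (φ : Isogeny W W') :
    Module.rank ℤ W.toAffine.Point ≤ Module.rank ℤ W'.toAffine.Point := by
  obtain ⟨f, hf⟩ := φ.exists_pointHom
  have hker := φ.ker_le_torsion_of_pointHom hf
  calc Module.rank ℤ W.toAffine.Point
      = Module.rank ℤ (W.toAffine.Point ⧸ LinearMap.ker f.toIntLinearMap) :=
        (rank_quotient_eq_of_le_torsion hker).symm
    _ = Module.rank ℤ (LinearMap.range f.toIntLinearMap) :=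
        (f.toIntLinearMap.quotKerEquivRange).rank_eq
    _ ≤ Module.rank ℤ W'.toAffine.Point := Submodule.rank_le _

/-- **Isogenous elliptic curves have the same Mordell–Weil rank** (isogeny form): for an isogeny
`φ : E → E'` of elliptic curves over a field of characteristic `0`,
`rank_ℤ E(K) = rank_ℤ E'(K)`, by `rank_point_le` for `φ` and for the dual isogeny `φ̂ : E' → E`
(`exists_dual_of_isElliptic`, Silverman *AEC* III.6.1). Milne, *ADT*, proof of Thm. I.7.3 (p. 97);
Silverman, *AEC*, III.6.2. [cite: MilneADT2006, proof of Thm. I.7.3 (p. 97)]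
[cite: SilvermanAEC2009, Thm. III.6.1(a) and III.6.2] -/
theorem mordellWeilRank_eq [CharZero K] [W.IsElliptic] [W'.IsElliptic] (φ : Isogeny W W') :
    W.mordellWeilRank = W'.mordellWeilRank := by
  obtain ⟨ψ, -⟩ := φ.exists_dual_of_isElliptic
  unfold mordellWeilRank Module.finrank
  rw [le_antisymm φ.rank_point_le ψ.rank_point_le]

end Isogeny

/-- **Isogenous elliptic curves have the same Mordell–Weil rank**: if `E ∼ E'` over a field `K` of
characteristic `0` then `rank_ℤ E(K) = rank_ℤ E'(K)`. Milne, *ADT*, proof of Thm. I.7.3 (p. 97);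
Silverman, *AEC*, III.6.2. [cite: MilneADT2006, proof of Thm. I.7.3 (p. 97)] -/
theorem IsIsogenous.mordellWeilRank_eq [CharZero K] [W.IsElliptic] [W'.IsElliptic]
    (h : IsIsogenous W W') : W.mordellWeilRank = W'.mordellWeilRank :=
  h.elim fun φ => φ.mordellWeilRank_eq

/-- **Discharge of the prelude fact `mordellWeilRank_eq_of_isIsogenous`** (`Isogeny.lean`):
over a number field, `K`-isogenous elliptic curves have the same Mordell–Weil rank
`rank_ℤ E(K) = finrank ℤ E(K)`. Proved by `IsIsogenous.mordellWeilRank_eq` (a number field has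
characteristic `0`); no Mordell–Weil theorem is used. Milne, *ADT*, proof of Thm. I.7.3 (p. 97);
Silverman, *AEC*, III.6.2 with VIII. [cite: MilneADT2006, proof of Thm. I.7.3 (p. 97)] -/
theorem mordellWeilRank_eq_of_isIsogenous_holds : mordellWeilRank_eq_of_isIsogenous (K := K) := by
  intro _ W W' _ _ h
  exact h.mordellWeilRank_eq

end WeierstrassCurve

end
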